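import Summits.Langlands.Langlands.Theses.ParityBlindBianchi
import Summits.Langlands.Langlands.Theorems.ParityBlindBianchiResidualBianchiDoorLevel
import HarnessLib

/-!
# `ResidualBianchiDoorLevelR` (E1′R, item stmt-Langlands-16621 of route ParityBlindBianchi) from the named facts

The rev-10 residual rung E1′R is E1′ `ParityBlindBianchi.ResidualBianchiDoorLevel` with the clause
`(0 : ℕ) ∉ S₀` added (the typing repair that kills the junk bad set `S₀ = {0, 2}` of
`ResidualBianchiDoorLevel.Negative.LoopholeRegAlgCuspidal`).  The landed line `Sketch` of the crux
E1′ (files `ParityBlindBianchiResidualBianchiDoorLevel{QLevel,CuspWitness,BcTransfer,…}.lean`)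
already returns a bad set of PRIMES, so the same composition proves E1′R modulo the same four in-tree
named facts, taken as hypotheses and never restated: `khare_wintenberger` (Khare–Wintenberger (I)
Thm 1.2 + 9.1 with Kisin 2009; all `p`, `k`, only `p = 2` used), `baseChange_cyclic_cuspidal`
(Arthur–Clozel Ch. 3 Thm 4.2 (a)), `ArthurClozel1989_strongLifting_archimedean` and
`ArthurClozel1989_strongLifting_allFinite` (Arthur–Clozel Ch. 3 Thm 5.1, archimedean / all finite
places).  The statement is spelled out verbatim from the ledger item (the route file is at rev 9 and
does not yet carry the decl `ResidualBianchiDoorLevelR`; once it does, the decl-typed corollary is a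
one-line `exact`).  Trust base: exactly the four named facts (`proof.conditional`).
-/

noncomputable section

namespace Summit.Langlands.Langlands.Theorems.ParityBlindBianchi

set_option linter.dupNamespace false

open scoped MatrixGroups Polynomial
open Polynomial NumberField IsDedekindDomain
open Literature.NumberTheory.Automorphic Literature.NumberTheory.GaloisRepresentations
  Summit.Langlands.Langlands.Cruxes.ResidualBianchiDoorLevel

/-- **E1′R from the named facts** (item stmt-Langlands-16621 `ResidualBianchiDoorLevelR`, stated
verbatim).  For `ι : ℚ̄₂ ≃+* ℂ` and an irreducible icosahedral Artin `ρ : Γ_ℚ → GL₂(ℂ)` there is a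
finite set `S₀` of naturals with `2 ∈ S₀` and `0 ∉ S₀` (indeed a set of primes) such that for every
imaginary quadratic `K` with `2` split, `σ := ι⁻¹ ∘ ρ|_{Γ_K}` entrywise is a framed representation
over `ℚ̄₂` of finite image, irreducible, projectively `A₅`, and a regular algebraic cuspidal `π₀`
on `GL₂(𝔸_K)` is congruent to `σ` (coefficientwise in `𝔪_{ℤ̄₂}`, HLTT normalisation `m = 2`) at
every place of `K` over no prime of `S₀`.  Proof: `Sketch.stub_qLevel` (Khare–Wintenberger at
`p = 2`, odd for free) gives the PRIME bad set `S ∋ 2`, the model `σ₀ = GL₂(ι⁻¹) ∘ ρ` and a regular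
algebraic cuspidal `π_ℚ` congruent to `σ₀` off `S`; `0 ∉ S` since `0` is not prime; per `K`,
`ResidualBianchiDoorMod2.exists_padicModel_restrictField` supplies `σ = σ₀|_{Γ_K}` with the four
Galois-side conjuncts, and `Sketch.stub_cuspWitness` + `Sketch.stub_bcTransfer` (cuspidal quadratic
base change + strong lifting at all places) give `π₀ = BC_K(π_ℚ)`.  CONDITIONAL on the four named
facts in the hypotheses (none restated here). -/
theorem ResidualBianchiDoorLevelR_of_facts
    (hKW : ∀ (p : ℕ) [Fact p.Prime] (k : Type) [Field k] [TopologicalSpace k] [DiscreteTopology k],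
      khare_wintenberger p k)
    (hBC : baseChange_cyclic_cuspidal) (hArch : ArthurClozel1989_strongLifting_archimedean)
    (hR1 : ArthurClozel1989_strongLifting_allFinite) :
    ∀ (ι : PadicAlgCl 2 ≃+* ℂ) (ρ : Literature.NumberTheory.GaloisRepresentations.FramedGaloisRep ℚ ℂ 2), ρ.toGaloisRep.IsIrreducible → Nonempty ((Matrix.ProjGenLinGroup.mk.comp ρ.toMonoidHom).range ≃* alternatingGroup (Fin 5)) → ∃ S₀ : Finset ℕ, 2 ∈ S₀ ∧ (0 : ℕ) ∉ S₀ ∧ ∀ (K : Type) [Field K] [NumberField K], NumberField.IsTotallyComplex K → Module.finrank ℚ K = 2 → (∃ v w : IsDedekindDomain.HeightOneSpectrum (NumberField.RingOfIntegers K), v ≠ w ∧ ((2 : ℕ) : NumberField.RingOfIntegers K) ∈ v.asIdeal ∧ ((2 : ℕ) : NumberField.RingOfIntegers K) ∈ w.asIdeal) → ∃ σ : Literature.NumberTheory.GaloisRepresentations.FramedGaloisRep K (PadicAlgCl 2) 2, (∀ (g : Field.absoluteGaloisGroup K) (i j : Fin 2), ι ((σ g).val i j) = ((Literature.NumberTheory.GaloisRepresentations.FramedGaloisRep.restrictField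 K ρ) g).val i j) ∧ Finite σ.toMonoidHom.range ∧ σ.toGaloisRep.IsIrreducible ∧ Nonempty ((Matrix.ProjGenLinGroup.mk.comp σ.toMonoidHom).range ≃* alternatingGroup (Fin 5)) ∧ ∃ (hcpt : Literature.NumberTheory.Automorphic.isCompact_glFiniteIntegralLevel 2 K) (π₀ : Literature.NumberTheory.Automorphic.CuspidalAutomorphicRepData 2 K hcpt), π₀.1.IsRegularAlgebraic ∧ ∀ v : IsDedekindDomain.HeightOneSpectrum (NumberField.RingOfIntegers K), (∀ ℓ ∈ S₀, ((ℓ : ℕ) : NumberField.RingOfIntegers K) ∉ v.asIdeal) → ∃ (α : Multiset ℂ) (P : Polynomial (PadicAlgCl 2)), π₀.1.HasSatakeParamAt v α ∧ σ.IsUnramifiedAt v ∧ σ.HasFrobCharpolyAt v P ∧ ∀ i : ℕ, ‖P.coeff i - (Literature.NumberTheory.Automorphic.arithFrobPolyOfSatake ι v.residueCard 2 α).coeff i‖ < 1 := by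
  intro ι ρ hirr hA5
  obtain ⟨S, h2S, hS, σ₀, hσ₀, hcptQ, πQ, hRA, hgood⟩ := Sketch.stub_qLevel hKW ι ρ hirr hA5
  refine ⟨S, h2S, fun h0 => Nat.not_prime_zero (hS 0 h0), ?_⟩
  intro K _ _ _htc hdeg _hsplit
  -- the Galois side: the same `σ₀`, restricted to `Γ_K`
  obtain ⟨σ₀', hσ₀', hfin, hproj, hmodel, hfinK, hirrK, hA5K⟩ :=
    Summit.Langlands.Langlands.Theorems.ResidualBianchiDoorMod2.exists_padicModel_restrictField
      ι ρ hA5 K hdeg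
  obtain rfl : σ₀' = σ₀ := Sketch.framedGaloisRep_eq_of_toMonoidHom_eq (hσ₀'.trans hσ₀.symm)
  -- the automorphic side over `K`: cuspidal quadratic base change of `π_ℚ`, strong at all places
  obtain ⟨hcpt, π₀, hRA₀, hgood₀⟩ := Sketch.stub_bcTransfer hBC hArch hR1 ι σ₀' S hcptQ πQ hRA
    hgood K hdeg (Sketch.stub_cuspWitness ι σ₀' hfin hproj S hS hcptQ πQ hgood K hdeg)
  exact ⟨σ₀'.restrictField K, hmodel, hfinK, hirrK, hA5K, hcpt, π₀, hRA₀, hgood₀⟩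

end Summit.Langlands.Langlands.Theorems.ParityBlindBianchi

end
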